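import Mathlib
import Literature.MathematicalPhysics.QuantumFieldTheory.Balaban1983to89.B4
import Literature.MathematicalPhysics.QuantumFieldTheory.Balaban1983to89.B6FromB4

/-!
# B6 for the operators G(Ω), Ω ⊃ Ω₁, Dirichlet boundary conditions on Ω^c — the compression principle behind
"All the reasonings and the results of this paper hold, with minor and obvious changes, for the operators G(Ω)"

T. Bałaban, *Propagators and renormalization transformations for lattice gauge theories. II*, Commun. Math. Phys.
**96** (1984) 223–250 [Balaban1984PropagatorsII] (= B6; its reference [3] = [Balaban1983RegularityDecay] = B4), read
from the ×2 page renders (journal page = PDF page + 222).  Consumer: T. Bałaban, *Propagators for lattice gauge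
theories in a background field*, Commun. Math. Phys. **99** (1985) 389–434 [Balaban1985BackgroundField] (= B9).
Unit b2b-balaban-b06-g2 (paper sub-cell B06 gen 2 of cell pub-balaban; journal claim G-B6-02-TRANSFER; GAPS row
G-B6-02 and its successors C-B6-7 / G-B6-02a / G-B6-13).  Companion document with the display-by-display census:
`run/shared/lean/pub/pub-balaban/b2b-balaban-b06-g2/B6-GOmega-transfer.md`.

VALUE = a kernel-checked inheritance lemma + a certificate-by-supplied-argument + located residuals; NOT summit
progress.  Nothing of B6 or B9 is proved here; the modules `…B4`, `…B6`, `…B6FromB4` are imported, not modified.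

## The printed assertion (verbatim) and its consumer

B6 p. 228 [PDF 6], after (2.35): *"Let us take a neighbourhood Ω of the domain Ω₁. We assume that it is a sum of big
blocks of the lattice T₁. For example we may take Ω = {a sum of big blocks of the lattice T₁ with distances to Ω₁ ≤ RM}.
We will consider operators with Dirichlet boundary conditions on Ω^c. … We may take also R defined by operators with
Dirichlet boundary conditions on Ω^c. Solving critical point equations for h(A, λ, ω) and denoting
G(Ω) = (Δ_a↾_Ω)⁻¹ = (ΩΔ_aΩ)⁻¹, we get … We have to notice only that the equalities (2.31), (2.34) hold for the operator
G(Ω) also. If B = 0 outside Ω₁, then the above representation simplifies and we get (2.35) with G(Ω) instead of G.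
All the reasonings and the results of this paper hold, with minor and obvious changes, for the operators G(Ω). We
choose Ω = T_η for simplicity of notation."*  B6 p. 248 [PDF 26], after Proposition 2.6: *"Let us also repeat once more
that this theorem holds for the operators G(Ω) with Dirichlet boundary conditions on Ω^c, Ω ⊃ Ω₁."*  B6 p. 229 [PDF 7],
(2.37): *"where G′(□) is an inverse of Δ′_a with some boundary conditions on the boundary of □, e.g. with Neumann
boundary conditions as in [3]."*
B9 p. 393: *"The only change we make is that the sequence (2.1) starts with Ω₀ … The condition (2.2) is unchanged. We
have introduced the domain Ω₀ because we will consider operators with Dirichlet boundary conditions on Ω₀^c"*;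
(3.27) G(U) = (Δ_a↾Ω₀)⁻¹; Cor. 3.5 p. 407: *"we can use the results of [4]. There we have proved these theorems for
operators with the external gauge field configuration U = 1"* ([4] of B9 = B6) — tree `…B9FromB6.DictAtOne`.

## The certificate (document §§0–8; summary)

G(Ω) = (ΩΔ_aΩ)⁻¹ is a COMPRESSION of B6's torus operator (p. 228 verbatim).  With a collar η⁻¹dist(Ω^c, Ω₁) ≥ 2
(B6's example has RM, B9 has (2.2)_{j=0} globally and 2R₀M₀ locally): (F1) the gauge space N(Q′) ((2.7), (2.10):
λ = 0 on Λ₀ ⊃ Ω^c) and hence the projections R (p. 225: onto ΔN(Q′) ⊂ L²(Ω)) and P = I − R are literally unchanged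
(R_Ω = 1_Ω R 1_Ω, P_Ω = P), so every Faddeev–Popov identity of Sects. A and C is verbatim on L²(Ω); (F2) every cube of
the cover 𝒟 (and its enlargements □̃, □̃³) that meets Ω^c meets the scale-0 region B⁰(Λ₀) ⊃ Ω^c, so — under B6's
standing two-consecutive-scales dichotomy for cubes (p. 230, p. 235, (2.89)) — its finer scale is 0 and its rescaled
lattice is the unit (η-)lattice; (F3) for such "cut cubes" replace each local inverse G′(□), C_□, G_□ by the inverse
of the compression of the SAME local operator to □ ∩ Ω: a compression inherits the quadratic-form window and the
kernel bound — i.e. condition (5.6) of the Sect. 5 Theorem of [3] p. 594 WITH THE SAME CONSTANTS (this file,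
`hyp56_compress`, kernel-checked) — hence, by that theorem ("for arbitrary Λ ⊂ Ω", constants "functions of δ₀, γ₀,
c₀", p. 597), the cut inverses obey (5.7) with the constants of the uncut family (`cutFamily_uniform`); on the unit
lattice the derivative / Hölder / Laplacian / L² entries of (2.43), (2.67), (2.133), (2.136)–(2.140) follow from the
kernel decay alone, and the lower bounds (2.78), (2.147) for cut cubes follow from the UPPER bound of the compressed
operator (`quadForm_compress_le`) instead of the Fourier / gauge-invariance arguments (2.75)–(2.76), (2.144)–(2.146).
Constants: functions of d, L (a = 1) only — the dependence B6 ((2.110), (2.147), Lemma 2.4) and B9 (Thm 3.1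
"dependent on d and L only") allow; uniform in k, η, {Ω_j}, Ω, M.

## What is kernel-checked here

`inclMatrix h` = the 0/1 matrix of the zero-extension L²(Λ) → L²(Ω) for Λ ⊆ Ω (on the index model `B4.Idx` of [3]
Sect. 5); `inclMatrix_transpose_mul_self` (ιᵀι = 1), `inclMatrix_conj` (ιᵀAι = `B4.compress h A` = "A_Λ = ΛAΛ"),
`inclMatrix_normSq` (‖ιw‖² = ‖w‖²), `quadForm_compress` (⟨w, A_Λw⟩ = ⟨ιw, Aιw⟩), `quadForm_compress_le/ge` (the window
is inherited), `hyp56_compress` ((5.6) on Ω ⇒ (5.6) on every Λ ⊆ Ω for the compression, same (γ₀, c₀, δ₀); a corollary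
of `B6FromB4.hyp56_sandwich` with C = ι, range 0, column sums 1), `CutFamilyUniform` / `cutFamily_uniform` (from
`B4.Sect5ThmUniform d N`: one pair (c₁, δ₁) serves every (Ω, A) with (5.6) at (γ₀, c₀, δ₀), every cut X ⊆ Ω and every
further localisation Λ ⊆ X — the cut local operators of the Ω-version of B6 are instances of the same theorem with
the same constants as the uncut ones).

## What remains named (not internalised; rows in GAPS.md)

(I1) `B4.Sect5ThmUniform` itself (census C-B4-3).  (I2) For the Sect. C cut cubes the local operator G_□ lives on the
torus T_□ = □̃³ (or "on the whole lattice ξZ^d", Prop. 2.5 p. 246), so [3]'s theorem is used on a torus / an infinite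
Ω — the same by-reference status as B6's own use at (2.152) (`B6FromB4` TYPING REMARK (iii), row G-pv09g2-1).  (I3)
The windows and kernel bounds of B6's UNCUT local operators at finer scale 0 (Prop. 2.5, (2.88)_loc, (2.43)/(2.79) at
j = 0): B6's own results, rows C-B6-3 / C-B6-5 with their leaves.  Residuals: (R1) Ω without a 2η-collar (e.g. Ω = Ω₁,
admitted by the letter of p. 248) is not covered — no downstream use; (R2) the two-consecutive-scales dichotomy for
□̃³ presupposes R ≥ 4dL in (2.2) (ℓ¹ metric, p. 223), a condition on R never stated in B6 ((2.59) fixes RM only) —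
shared by the T_η and Ω versions, row G-B6-13.
-/

namespace Literature.MathematicalPhysics.QuantumFieldTheory.Balaban1983to89.B6GOmega

open Literature.MathematicalPhysics.QuantumFieldTheory.Balaban1983to89
open Finset
open scoped Matrix

section Compression

variable {d N : ℕ}

/-- The index inclusion of [3] Sect. 5 ("Λ ⊂ Ω") is injective. [folklore] -/
theorem inclIdx_injective {Ω Λ : Finset (Fin d → ℤ)} (h : Λ ⊆ Ω) :
    Function.Injective (B4.inclIdx (N := N) h) := by
  rintro ⟨⟨x, hx⟩, i⟩ ⟨⟨y, hy⟩, j⟩ hpq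
  simp only [B4.inclIdx, Prod.mk.injEq, Subtype.mk.injEq] at hpq
  obtain ⟨rfl, rfl⟩ := hpq
  rfl

/-- The position of an included index is the position of the index. [folklore] -/
theorem inclIdx_pos {Ω Λ : Finset (Fin d → ℤ)} (h : Λ ⊆ Ω) (k : B4.Idx Λ N) :
    ((B4.inclIdx h k).1 : Fin d → ℤ) = (k.1 : Fin d → ℤ) := rfl

/-- The zero-extension L²(Λ) → L²(Ω), Λ ⊆ Ω, as a 0/1 matrix ι (ι(x, x′) = 1 iff x = x′ ∈ Λ): the operator written "Λ"
(multiplication by the indicator, followed by the inclusion) in "A_Λ = ΛAΛ" of [3] p. 594 and "G(Ω) = (ΩΔ_aΩ)⁻¹" of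
B6 p. 228. [cite: Balaban1984PropagatorsII, p.228] -/
def inclMatrix {Ω Λ : Finset (Fin d → ℤ)} (h : Λ ⊆ Ω) : Matrix (B4.Idx Ω N) (B4.Idx Λ N) ℝ :=
  Matrix.of fun p k => if p = B4.inclIdx h k then 1 else 0

/-- Entry formula of ι. [folklore] -/
theorem inclMatrix_apply {Ω Λ : Finset (Fin d → ℤ)} (h : Λ ⊆ Ω) (p : B4.Idx Ω N) (k : B4.Idx Λ N) :
    inclMatrix h p k = if p = B4.inclIdx h k then 1 else 0 := rfl

/-- ιᵀι = 1 on L²(Λ): the zero-extension is an isometry. [folklore] -/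
theorem inclMatrix_transpose_mul_self {Ω Λ : Finset (Fin d → ℤ)} (h : Λ ⊆ Ω) :
    (inclMatrix (N := N) h)ᵀ * inclMatrix (N := N) h = (1 : Matrix (B4.Idx Λ N) (B4.Idx Λ N) ℝ) := by
  ext k k'
  simp only [Matrix.mul_apply, Matrix.transpose_apply, inclMatrix_apply, Matrix.one_apply]
  rw [Finset.sum_eq_single (B4.inclIdx h k)]
  · by_cases hkk : k = k'
    · subst hkk; simp
    · have hne : B4.inclIdx (N := N) h k ≠ B4.inclIdx h k' := fun e => hkk (inclIdx_injective h e)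
      simp [hne, hkk]
  · intro p _ hp; simp [hp]
  · intro hk; exact absurd (Finset.mem_univ _) hk

/-- ιᵀAι = A_Λ: conjugating by the zero-extension is the compression "A_Λ = ΛAΛ" of [3] p. 594 (`B4.compress`), i.e.
B6's "ΩΔ_aΩ" (p. 228) for a sub-domain. [cite: Balaban1983RegularityDecay, Sect. 5 Theorem p.594] -/
theorem inclMatrix_conj {Ω Λ : Finset (Fin d → ℤ)} (h : Λ ⊆ Ω) (A : Matrix (B4.Idx Ω N) (B4.Idx Ω N) ℝ) :
    (inclMatrix (N := N) h)ᵀ * A * inclMatrix (N := N) h = B4.compress h A := by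
  ext k k'
  simp only [B4.compress, Matrix.submatrix_apply, Matrix.mul_apply, Matrix.transpose_apply, inclMatrix_apply]
  have inner : ∀ q : B4.Idx Ω N,
      ∑ p, (if p = B4.inclIdx h k then (1 : ℝ) else 0) * A p q = A (B4.inclIdx h k) q := by
    intro q
    rw [Finset.sum_eq_single (B4.inclIdx h k)]
    · simp
    · intro p _ hp; simp [hp]
    · intro hk; exact absurd (Finset.mem_univ _) hk
  simp_rw [inner]
  rw [Finset.sum_eq_single (B4.inclIdx h k')]
  · simp
  · intro q _ hq; simp [hq]
  · intro hk; exact absurd (Finset.mem_univ _) hk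

/-- ‖ιw‖² = ‖w‖². [folklore] -/
theorem inclMatrix_normSq {Ω Λ : Finset (Fin d → ℤ)} (h : Λ ⊆ Ω) (w : B4.Idx Λ N → ℝ) :
    ∑ u, (inclMatrix h *ᵥ w) u ^ 2 = ∑ k, w k ^ 2 := by
  have h1 : ∑ u, (inclMatrix h *ᵥ w) u ^ 2 = (inclMatrix h *ᵥ w) ⬝ᵥ (inclMatrix h *ᵥ w) := by
    simp [dotProduct, pow_two]
  have h2 : w ⬝ᵥ (((inclMatrix (N := N) h)ᵀ * inclMatrix (N := N) h) *ᵥ w) =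
      (inclMatrix h *ᵥ w) ⬝ᵥ (inclMatrix h *ᵥ w) := by
    rw [← Matrix.mulVec_mulVec, Matrix.dotProduct_mulVec, Matrix.vecMul_transpose]
  rw [h1, ← h2, inclMatrix_transpose_mul_self, Matrix.one_mulVec]
  simp [dotProduct, pow_two]

/-- The column sums of ι are 1 (ι is "short-ranged" with range 0 and ℓ¹-column bound 1 in the sense of
`B6FromB4.sandwich_decay`). [folklore] -/
theorem inclMatrix_colSum {Ω Λ : Finset (Fin d → ℤ)} (h : Λ ⊆ Ω) (k : B4.Idx Λ N) :
    ∑ p, |inclMatrix h p k| = 1 := by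
  rw [Finset.sum_eq_single (B4.inclIdx h k)]
  · simp [inclMatrix_apply]
  · intro p _ hp; simp [inclMatrix_apply, hp]
  · intro hk; exact absurd (Finset.mem_univ _) hk

/-- ι has range 0: ι(x, x′) ≠ 0 forces the positions to coincide. [folklore] -/
theorem inclMatrix_range {Ω Λ : Finset (Fin d → ℤ)} (h : Λ ⊆ Ω) (p : B4.Idx Ω N) (k : B4.Idx Λ N)
    (hpk : inclMatrix h p k ≠ 0) : dist (p.1 : Fin d → ℤ) (k.1 : Fin d → ℤ) ≤ 0 := by
  have hp : p = B4.inclIdx h k := by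
    by_contra hne
    exact hpk (by simp [inclMatrix_apply, hne])
  subst hp
  rw [inclIdx_pos h k, dist_self]

/-- ⟨w, A_Λw⟩ = ⟨ιw, Aιw⟩: the quadratic form of the compression is the quadratic form of A on zero-extended vectors —
the one-line content of "G(Ω) = (Δ_a↾_Ω)⁻¹ = (ΩΔ_aΩ)⁻¹" (B6 p. 228) used throughout the certificate.
[cite: Balaban1984PropagatorsII, p.228] -/
theorem quadForm_compress {Ω Λ : Finset (Fin d → ℤ)} (h : Λ ⊆ Ω) (A : Matrix (B4.Idx Ω N) (B4.Idx Ω N) ℝ)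
    (w : B4.Idx Λ N → ℝ) :
    ∑ k, w k * (B4.compress h A *ᵥ w) k = ∑ u, (inclMatrix h *ᵥ w) u * (A *ᵥ (inclMatrix h *ᵥ w)) u := by
  rw [← inclMatrix_conj]
  change w ⬝ᵥ (((inclMatrix (N := N) h)ᵀ * A * inclMatrix (N := N) h) *ᵥ w) =
    (inclMatrix h *ᵥ w) ⬝ᵥ (A *ᵥ (inclMatrix h *ᵥ w))
  rw [← Matrix.mulVec_mulVec, ← Matrix.mulVec_mulVec, Matrix.dotProduct_mulVec, Matrix.vecMul_transpose]

/-- KERNEL-CHECKED (certificate (E1), upper half): an upper bound A ≤ ΓI passes to every compression A_Λ ≤ ΓI.  Used for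
cut cubes to get the LOWER bounds of the inverses, (2.78)_cut and (2.147)_cut: A_Λ⁻¹ ≥ Γ⁻¹ on L²(Λ), replacing the
Fourier argument (2.75)–(2.76) p. 236 and the gauge-invariance argument (2.144)–(2.146) p. 248 for those cubes.
[cite: Balaban1984PropagatorsII, (2.78) p.236; (2.147) p.248] -/
theorem quadForm_compress_le {Ω Λ : Finset (Fin d → ℤ)} (h : Λ ⊆ Ω) {A : Matrix (B4.Idx Ω N) (B4.Idx Ω N) ℝ}
    {Γ : ℝ} (hup : ∀ v : B4.Idx Ω N → ℝ, ∑ p, v p * (A *ᵥ v) p ≤ Γ * ∑ p, v p ^ 2) :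
    ∀ w : B4.Idx Λ N → ℝ, ∑ k, w k * (B4.compress h A *ᵥ w) k ≤ Γ * ∑ k, w k ^ 2 := by
  intro w
  rw [quadForm_compress, ← inclMatrix_normSq h w]
  exact hup _

/-- KERNEL-CHECKED (certificate (E1), lower half): a lower bound A ≥ γI passes to every compression A_Λ ≥ γI (min–max /
zero-extension). [cite: Balaban1983RegularityDecay, (5.6) p.594] -/
theorem quadForm_compress_ge {Ω Λ : Finset (Fin d → ℤ)} (h : Λ ⊆ Ω) {A : Matrix (B4.Idx Ω N) (B4.Idx Ω N) ℝ}
    {γ : ℝ} (hlow : ∀ v : B4.Idx Ω N → ℝ, γ * ∑ p, v p ^ 2 ≤ ∑ p, v p * (A *ᵥ v) p) :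
    ∀ w : B4.Idx Λ N → ℝ, γ * ∑ k, w k ^ 2 ≤ ∑ k, w k * (B4.compress h A *ᵥ w) k := by
  intro w
  rw [quadForm_compress, ← inclMatrix_normSq h w]
  exact hlow _

/-- KERNEL-CHECKED (certificate (E1) = the load-bearing "minor change"): condition **(5.6)** of the Sect. 5 Theorem of
[3] p. 594 — *"A ≥ γ₀I, |A(x,x′)| ≤ c₀e^{−δ₀|x−x′|}, x, x′ ∈ Ω"*, symmetric — passes from (Ω, A) to (Λ, A_Λ) for every
Λ ⊆ Ω WITH THE SAME CONSTANTS (γ₀, c₀, δ₀).  Hence a local operator of B6 cut by the Dirichlet condition on Ω^c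
("ΩΔ_aΩ", p. 228; for the cubes: "some boundary conditions on the boundary of □", p. 229) is as good an input to [3]'s
theorem as the uncut one.  Proof: `B6FromB4.hyp56_sandwich` with C = ι (range 0, column sums 1, ‖ιw‖ = ‖w‖) and
ιᵀAι = A_Λ. [cite: Balaban1984PropagatorsII, p.228 + p.248; Balaban1983RegularityDecay, (5.6) p.594] -/
theorem hyp56_compress {Ω Λ : Finset (Fin d → ℤ)} (h : Λ ⊆ Ω) {A : Matrix (B4.Idx Ω N) (B4.Idx Ω N) ℝ}
    {γ₀ c₀ δ₀ : ℝ} (hγ : 0 ≤ γ₀) (hc : 0 ≤ c₀) (hδ : 0 ≤ δ₀) (hA : B4.Hyp56 Ω A γ₀ c₀ δ₀) :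
    B4.Hyp56 Λ (B4.compress h A) γ₀ c₀ δ₀ := by
  obtain ⟨hs, hl, hd⟩ := hA
  have H := B6FromB4.hyp56_sandwich (inclMatrix (N := N) h) A (r := 0) (mC := 1) hγ hc hδ hs hd
    (fun w => hl (inclMatrix h *ᵥ w)) (fun w => (inclMatrix_normSq h w).symm.le)
    (fun p k hpk => inclMatrix_range h p k hpk) (fun k => (inclMatrix_colSum h k).le)
  rw [inclMatrix_conj] at H
  simpa using H

end Compression

/-! ## The cut-cube uniformity: cut local operators are instances of [3]'s theorem with the uncut constants -/

section CutCubes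

variable (d N : ℕ)

/-- The statement the certificate uses for every CUT cube of B6's covers (Sect. B: G′(□)_X, C_{□,Ω}; Sect. C via the
torus reading, see the module docstring (I2)) — a typed READING of the printed sentence, PROVED below from
`B4.Sect5ThmUniform` (`cutFamily_uniform`; no new leaf): for each (γ₀, c₀, δ₀) ONE pair (c₁, δ₁) such that for every finite
Ω ⊂ ℤ^d, every A with (5.6) on Ω, every cut X ⊆ Ω (X = the part inside B6's Ω of the cube's index set) and every
further Λ ⊆ X, the compressed operator A_X obeys (5.7)–(5.8) on (X, Λ) with (c₁, δ₁) — the SAME pair that serves the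
uncut family (X = Ω).  This is the typed form of "with minor and obvious changes" for the local inverses: B6 p. 228,
p. 248. [cite: Balaban1984PropagatorsII, p.228 + p.248; Balaban1983RegularityDecay, Sect. 5 Theorem p.594] -/
def CutFamilyUniform : Prop :=
  ∀ γ₀ c₀ δ₀ : ℝ, 0 < γ₀ → 0 < c₀ → 0 < δ₀ → ∃ c₁ δ₁ : ℝ, 0 < c₁ ∧ 0 < δ₁ ∧
    ∀ (Ω : Finset (Fin d → ℤ)) (A : Matrix (B4.Idx Ω N) (B4.Idx Ω N) ℝ), B4.Hyp56 Ω A γ₀ c₀ δ₀ →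
      ∀ (X : Finset (Fin d → ℤ)) (hX : X ⊆ Ω) (Λ : Finset (Fin d → ℤ)) (hΛ : Λ ⊆ X),
        B4.Concl57_58 X Λ hΛ (B4.compress hX A) c₁ δ₁

variable {d N}

/-- KERNEL-CHECKED: the uniform reading of [3]'s Sect. 5 Theorem (`B4.Sect5ThmUniform`, census C-B4-3) gives the
cut-cube uniformity outright, because by `hyp56_compress` the cut operator A_X is itself an admissible (Ω := X, A := A_X)
with the same (γ₀, c₀, δ₀).  No Dirichlet version of [3]'s Lemmas 2.2/2.4/Prop. 2.3 is needed for B6's cut cubes: they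
have finer scale 0 (document (F2)), so they are unit-lattice operators and this theorem is the whole input.
[cite: Balaban1984PropagatorsII, p.228 + p.248; Balaban1983RegularityDecay, Sect. 5 Theorem p.594 + p.597] -/
theorem cutFamily_uniform (h5 : B4.Sect5ThmUniform d N) : CutFamilyUniform d N := by
  intro γ₀ c₀ δ₀ hγ hc hδ
  obtain ⟨c₁, δ₁, hc₁, hδ₁, H⟩ := h5 γ₀ c₀ δ₀ hγ hc hδ
  refine ⟨c₁, δ₁, hc₁, hδ₁, ?_⟩
  intro Ω A hA X hX Λ hΛ
  exact (H X (B4.compress hX A) (hyp56_compress hX hγ.le hc.le hδ.le hA)).1 Λ hΛ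

/-- KERNEL-CHECKED, the uncut family is the special case X = Ω of the cut family (so the constants are literally shared):
`B4.compress (Subset.refl Ω) A = A` by `B6FromB4.compress_refl`. [folklore] -/
theorem uncut_of_cutFamily (hc : CutFamilyUniform d N) :
    ∀ γ₀ c₀ δ₀ : ℝ, 0 < γ₀ → 0 < c₀ → 0 < δ₀ → ∃ c₁ δ₁ : ℝ, 0 < c₁ ∧ 0 < δ₁ ∧
      ∀ (Ω : Finset (Fin d → ℤ)) (A : Matrix (B4.Idx Ω N) (B4.Idx Ω N) ℝ), B4.Hyp56 Ω A γ₀ c₀ δ₀ →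
        ∀ (Λ : Finset (Fin d → ℤ)) (hΛ : Λ ⊆ Ω), B4.Concl57_58 Ω Λ hΛ A c₁ δ₁ := by
  intro γ₀ c₀ δ₀ hγ hc0 hδ
  obtain ⟨c₁, δ₁, hc₁, hδ₁, H⟩ := hc γ₀ c₀ δ₀ hγ hc0 hδ
  refine ⟨c₁, δ₁, hc₁, hδ₁, ?_⟩
  intro Ω A hA Λ hΛ
  have := H Ω A hA Ω (Finset.Subset.refl Ω) Λ hΛ
  rwa [B6FromB4.compress_refl] at this

end CutCubes

end Literature.MathematicalPhysics.QuantumFieldTheory.Balaban1983to89.B6GOmega
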